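import Mathlib
import Summits.MatrixMultiplication.MatrixMultiplication.Theorems.SubgroupIdentityDesigns.Negative.PackingBridge

/-!
# Subgroup TPP: the shape of the condition, and a triple with `V > |G|` inside `GL₂(𝔽₂)`
# (support lemma for stmt-MatrixMultiplication-14079; cell B2b-5 `b2b-lgcu-borel`, gen 11 —
# report `run/shared/lean/b2b/levelgraded-cu/ORACLE-g11.md` §G11-1b)

Two elementary facts about the crux's packing notion
`SubgroupTPP H₁ H₂ H₃ := ∀ a ∈ H₁, ∀ b ∈ H₂, ∀ c ∈ H₃, a * b * c = 1 → a = 1 ∧ b = 1 ∧ c = 1`,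
recorded because the tempting "lemma" `|H₁||H₂||H₃| ≤ |G|` is FALSE for it and must not be used when
bounding witness volumes (the only proven caps are the walls `2V² ≤ (dim F_k|_G)³`,
`PackingBridge.crux_walls`, and the shell `WitnessShell.crux_shell`):

* `subgroupTPP_iff` — `SubgroupTPP H₁ H₂ H₃ ↔ (H₁ ⊓ H₂ trivial) ∧ (H₁H₂ meets H₃ only in 1)`
  (as `a b c = 1 ↔ a b = c⁻¹`); in particular the condition is one-sided in `H₃`.
* `exists_tpp_volume_gt_card` — in `GL₂(𝔽₂)` (order `6`) the three subgroups of order `2`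
  generated by `[[1,1],[0,1]]`, `[[1,0],[1,1]]`, `[[0,1],[1,0]]` satisfy the subgroup TPP with
  `V = |H₁||H₂||H₃| = 8 > 6 = |GL₂(𝔽₂)|` (kernel-checked by `decide` on the `2 × 2 × 2` products).

Sorry-free; standard axioms.  VALUE = theorem (negative knowledge about the packing notion),
NOT summit progress; the crux item stays open.
-/

set_option linter.dupNamespace false

open Literature.Barriers.MatrixMultiplication (SubgroupTPP)

namespace Summit.MatrixMultiplication.MatrixMultiplication.Theorems.SubgroupIdentityDesigns.Negative
namespace VolumeExceedsOrder

/-- **Shape of the subgroup TPP**: `H₁ ∩ H₂ = 1` and `H₁H₂ ∩ H₃ = 1` (nothing more). [folklore] -/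
theorem subgroupTPP_iff {G : Type} [Group G] (H₁ H₂ H₃ : Subgroup G) :
    SubgroupTPP H₁ H₂ H₃ ↔
      (∀ a ∈ H₁, a ∈ H₂ → a = 1) ∧ (∀ a ∈ H₁, ∀ b ∈ H₂, a * b ∈ H₃ → a = 1 ∧ b = 1) := by
  constructor
  · intro h
    refine ⟨fun a ha ha2 => ?_, fun a ha b hb hab => ?_⟩
    · have := h a ha a⁻¹ (H₂.inv_mem ha2) 1 H₃.one_mem (by simp)
      exact this.1
    · have := h a ha b hb (a * b)⁻¹ (H₃.inv_mem hab) (by simp)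
      exact ⟨this.1, this.2.1⟩
  · rintro ⟨-, h2⟩ a ha b hb c hc habc
    have hab : a * b = c⁻¹ := eq_inv_of_mul_eq_one_left habc
    have hab3 : a * b ∈ H₃ := hab ▸ H₃.inv_mem hc
    obtain ⟨rfl, rfl⟩ := h2 a ha b hb hab3
    exact ⟨rfl, rfl, by simpa using habc⟩

/-- **A subgroup-TPP triple with `V > |G|`** inside the crux's own host family: in `GL₂(𝔽₂)`,
`|H₁||H₂||H₃| = 8 > 6 = |GL₂(𝔽₂)|` for the three order-`2` subgroups `⟨[[1,1],[0,1]]⟩`,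
`⟨[[1,0],[1,1]]⟩`, `⟨[[0,1],[1,0]]⟩`.  So `V ≤ |G|` is NOT available for witnesses of the crux.
[folklore] -/
theorem exists_tpp_volume_gt_card :
    ∃ H₁ H₂ H₃ : Subgroup (GL (Fin 2) (ZMod 2)), SubgroupTPP H₁ H₂ H₃ ∧
      Nat.card (GL (Fin 2) (ZMod 2)) < Nat.card H₁ * Nat.card H₂ * Nat.card H₃ := by
  -- an involution `x` spans the subgroup `{1, x}`
  have mk2 : ∀ x : GL (Fin 2) (ZMod 2), x * x = 1 →
      ∃ H : Subgroup (GL (Fin 2) (ZMod 2)), (H : Set (GL (Fin 2) (ZMod 2))) = {1, x} := by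
    intro x hx
    refine ⟨{ carrier := {1, x}, mul_mem' := ?_, one_mem' := by simp, inv_mem' := ?_ }, rfl⟩
    · intro a b ha hb
      simp only [Set.mem_insert_iff, Set.mem_singleton_iff] at ha hb ⊢
      rcases ha with rfl | rfl <;> rcases hb with rfl | rfl <;> simp [hx]
    · intro a ha
      simp only [Set.mem_insert_iff, Set.mem_singleton_iff] at ha ⊢
      rcases ha with rfl | rfl
      · simp
      · exact Or.inr (inv_eq_of_mul_eq_one_left hx)
  -- the three involutions
  set x : GL (Fin 2) (ZMod 2) := ⟨!![1, 1; 0, 1], !![1, 1; 0, 1], by decide, by decide⟩ with hxdef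
  set y : GL (Fin 2) (ZMod 2) := ⟨!![1, 0; 1, 1], !![1, 0; 1, 1], by decide, by decide⟩ with hydef
  set w : GL (Fin 2) (ZMod 2) := ⟨!![0, 1; 1, 0], !![0, 1; 1, 0], by decide, by decide⟩ with hwdef
  have hx : x * x = 1 := by decide
  have hy : y * y = 1 := by decide
  have hw : w * w = 1 := by decide
  have hx1 : (1 : GL (Fin 2) (ZMod 2)) ≠ x := by decide
  have hy1 : (1 : GL (Fin 2) (ZMod 2)) ≠ y := by decide
  have hw1 : (1 : GL (Fin 2) (ZMod 2)) ≠ w := by decide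
  obtain ⟨H₁, hH₁⟩ := mk2 x hx
  obtain ⟨H₂, hH₂⟩ := mk2 y hy
  obtain ⟨H₃, hH₃⟩ := mk2 w hw
  refine ⟨H₁, H₂, H₃, ?_, ?_⟩
  · -- the `2 × 2 × 2` products: only `1 · 1 · 1 = 1`
    intro a ha b hb c hc habc
    have ha' : a ∈ ({1, x} : Set (GL (Fin 2) (ZMod 2))) := by rw [← hH₁]; exact ha
    have hb' : b ∈ ({1, y} : Set (GL (Fin 2) (ZMod 2))) := by rw [← hH₂]; exact hb
    have hc' : c ∈ ({1, w} : Set (GL (Fin 2) (ZMod 2))) := by rw [← hH₃]; exact hc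
    simp only [Set.mem_insert_iff, Set.mem_singleton_iff] at ha' hb' hc'
    rcases ha' with rfl | rfl <;> rcases hb' with rfl | rfl <;> rcases hc' with rfl | rfl <;>
      revert habc <;> decide
  · -- `|G| = 6 < 8 = 2 · 2 · 2`
    have c1 : Nat.card H₁ = 2 := by
      rw [← SetLike.coe_sort_coe, hH₁, Nat.card_coe_set_eq, Set.ncard_pair hx1]
    have c2 : Nat.card H₂ = 2 := by
      rw [← SetLike.coe_sort_coe, hH₂, Nat.card_coe_set_eq, Set.ncard_pair hy1]
    have c3 : Nat.card H₃ = 2 := by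
      rw [← SetLike.coe_sort_coe, hH₃, Nat.card_coe_set_eq, Set.ncard_pair hw1]
    have cG : Nat.card (GL (Fin 2) (ZMod 2)) = 6 := by
      rw [Nat.card_eq_fintype_card]; decide
    rw [c1, c2, c3, cG]
    norm_num

end VolumeExceedsOrder
end Summit.MatrixMultiplication.MatrixMultiplication.Theorems.SubgroupIdentityDesigns.Negative
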